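import Summits.QuantumFields.BalabanUV.Beta.EriceRemainderEnclosureHistoryAutonomyComparisonDualContractionEnd
import Summits.QuantumFields.BalabanUV.Beta.EriceRemainderEnclosureHistoryAutonomyComparisonDualContractionClosed
import Summits.QuantumFields.BalabanUV.Beta.EriceRemainderEnclosureHistoryAutonomyComparisonIsotoneExcessSharp

/-!
# EriceRemainderEnclosureHistoryAutonomyComparisonDualContractionHinge — (E138d) **THE HINGE DICHOTOMY.**  (E56a) `…ComparisonIsotoneExcessSharp` displays the isotone
# hinge memory `B(u) = b + M̃·max(1 − 1∕u_L², 0)` (one term of age `L`, slope `M̃` in the LEVEL of age `L`) and proves that its translate `B′ = B + ε` produces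
# `h 1 < h′ 1` from one pin under `η = (L+1)ε − x`, `M̃η = x`, `ε < x` — hypotheses that force **`L·M̃ > 1`** (`x = M̃(L+1)ε∕(1+M̃) > ε ⟺ L·M̃ > 1`).  THIS FILE is the
# other side: the same memory has the one-age level profile `Λ_L = M̃`, age moment `L·M̃`, so by (E138e) `le_of_isotone_excess_moment_le_one` it compares with EVERY
# bounded `B′ ≥ B` of ISOTONE excess, from EVERY pin, at every scale, as soon as **`L·M̃ ≤ 1`** (`hinge_le_of_moment_le_one`); in particular the translate
# (`hinge_translate_le`).  The comparison threshold of the one-age level hinge is therefore EXACTLY `L·M̃ = 1`, boundary included on the comparison side: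
# **comparison ⟺ `L·M̃ ≤ 1`**.

Cell `pub-balaban`, β-function sub-cell, BINDER row D4 «RemainderConst leaves for Bałaban's split» (`HOME/BINDER-OWNERS.md`; owner lineage `b2b-balaban-beta-an4`;
this file by co-owner #2 lineage `b2b-balaban-beta-d4-p2`, generation 106), β-FLOW TEAM duty (1), FREEZE (0) honoured (def-free; (E138e) `le_of_isotone_excess_moment_le_one`,
(E138c) `hinge_sub_hinge_le`, (E56a)'s displayed hinge functional with its `B_isotone` ∕ `B_zerothMoment` ∕ `floor_le_B` ∕ `B_le_B'` BY NAME; nothing restated).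

HONEST FRAMING (page 1, verbatim and binding).  *"Discharging BetaPertH makes Bałaban's UV stability UNCONDITIONAL — a real constructive-QFT result; it is
NOT the continuum limit and NOT the Clay problem."*  THIS FILE DISCHARGES NOTHING OF THE KIND.  Elementary real analysis about a DISPLAYED abstract functional on a
box ]0,γ]^ℕ — a census example, not a fact; nothing about Bałaban's (1.22) limit functional is PRINTED in this form ([I] p. 298; GAPS G-t4-U2-1∕-2) or asserted.
Row D4 class UNCHANGED (critical-path width 0; instance 0∕1; D4 DISCHARGE NO DATE).  NOT B12 Thm 2, NOT BetaPertH, NOT continuum YM, NOT Clay.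

WHAT IS PROVED ([folklore]; 0 `def`, 0 sorry).  **`hinge_le_of_moment_le_one`**, **`hinge_translate_le`**.
-/
noncomputable section
open Finset Set

namespace Summit.QuantumFields.BalabanUV.Beta.EriceRemainderEnclosureHistoryAutonomyComparisonDualContractionHinge

open Literature.MathematicalPhysics.QuantumFieldTheory.Balaban1983to89
open Literature.MathematicalPhysics.QuantumFieldTheory.Balaban1983to89.T4BetaStationary
open Literature.MathematicalPhysics.QuantumFieldTheory.Balaban1983to89.T4BetaFlowWellPosed
open Summit.QuantumFields.BalabanUV.Beta.EriceRemainderEnclosureHistoryAutonomyComparisonDualContractionClosed (le_of_isotone_excess_moment_le_one)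
open Summit.QuantumFields.BalabanUV.Beta.EriceRemainderEnclosureHistoryAutonomyComparisonDualContractionEnd (hinge_sub_hinge_le)
open Summit.QuantumFields.BalabanUV.Beta.EriceRemainderEnclosureHistoryAutonomyComparisonIsotoneExcessSharp
  (floor_le_B B_isotone B_zerothMoment B_le_B')

variable {B' : (ℕ → ℝ) → ℝ} {γ b : ℝ} {h h' : ℕ → ℝ}

/-! ## The hinge dichotomy: (E56a)'s memory compares as soon as `L·M̃ ≤ 1` -/

/-- **THE POSITIVE SIDE OF THE HINGE DICHOTOMY.**  (E56a)'s isotone hinge memory `B(u) = b + M̃·max(1 − 1∕u_L², 0)` (`b > 0`, `M̃ ≥ 0`, one term of age `L`,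
slope `M̃` in the LEVEL of age `L`) has the one-age profile `Λ_L = M̃`, age moment `L·M̃`.  If **`L·M̃ ≤ 1`** then for EVERY functional `B′` with `B ≤ B′ ≤ β̄` on the
box `]0,γ]^ℕ` and ISOTONE excess, from every pin `p ∈ ]0,γ]`, any box solutions satisfy `h′ ≤ h` at every scale — whereas (E56a) `h_one_lt_h'_one` produces `h 1 < h′ 1`
for the translate `B + ε` under `η = (L+1)ε − x`, `M̃η = x`, `ε < x`, i.e. exactly when `L·M̃ > 1`. [folklore] -/
theorem hinge_le_of_moment_le_one {Mt βb p : ℝ} {L : ℕ} (hb : 0 < b) (hMt : 0 ≤ Mt) (hLM : (L : ℝ) * Mt ≤ 1)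
    (hexc : ∀ u, SeqBox γ u → (fun w : ℕ → ℝ => b + Mt * max (1 - 1 / w L ^ 2) 0) u ≤ B' u) (hbdd : ∀ u, SeqBox γ u → B' u ≤ βb)
    (hDmono : ∀ u v : ℕ → ℝ, SeqBox γ u → SeqBox γ v → (∀ i, u i ≤ v i) →
      B' u - (fun w : ℕ → ℝ => b + Mt * max (1 - 1 / w L ^ 2) 0) u ≤ B' v - (fun w : ℕ → ℝ => b + Mt * max (1 - 1 / w L ^ 2) 0) v)
    (hp : 0 < p) (hpγ : p ≤ γ) (hh : SeqBox γ h) (hf : MemFlow (fun w : ℕ → ℝ => b + Mt * max (1 - 1 / w L ^ 2) 0) p h)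
    (hh' : SeqBox γ h') (hf' : MemFlow B' p h') (j : ℕ) : h' j ≤ h j := by
  refine le_of_isotone_excess_moment_le_one (K := L + 1) (Λ := fun k => if k = L then Mt else 0) (M := 2 * Mt)
    (B_isotone hMt) (B_zerothMoment hMt) (by positivity) hb (fun u _ => floor_le_B hMt u)
    (fun k => show 0 ≤ (if k = L then Mt else 0) from by split_ifs <;> linarith) ?_ ?_ hexc hbdd hDmono hp hpγ hh hf hh' hf' j
  · -- the age moment is L·M̃
    have e : ∑ k ∈ range (L + 1), (k : ℝ) * (if k = L then Mt else 0) = (L : ℝ) * Mt := by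
      rw [sum_range_succ, if_pos rfl, sum_eq_zero (fun k hk => by rw [if_neg (by simpa using (mem_range.mp hk).ne), mul_zero]), zero_add]
    rw [e]; exact hLM
  · -- the one-age level profile
    intro u v _ _ _ _
    show b + Mt * max (1 - 1 / u L ^ 2) 0 - (b + Mt * max (1 - 1 / v L ^ 2) 0)
      ≤ ∑ k ∈ range (L + 1), (if k = L then Mt else 0) * max (1 / v k ^ 2 - 1 / u k ^ 2) 0
    have e : ∑ k ∈ range (L + 1), (if k = L then Mt else 0) * max (1 / v k ^ 2 - 1 / u k ^ 2) 0 = Mt * max (1 / v L ^ 2 - 1 / u L ^ 2) 0 := by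
      rw [sum_range_succ, if_pos rfl, sum_eq_zero (fun k hk => by rw [if_neg (by simpa using (mem_range.mp hk).ne), zero_mul]), zero_add]
    rw [e]
    have := mul_le_mul_of_nonneg_left (hinge_sub_hinge_le (1 / u L ^ 2) (1 / v L ^ 2)) hMt
    linarith

/-- **THE TRANSLATE, POSITIVE SIDE** — the exact counterpart of (E56a) `h_one_lt_h'_one`: `B(u) = b + M̃·max(1 − 1∕u_L², 0)`, `B′ = B + ε` (`ε ≥ 0`), `L·M̃ ≤ 1`;
then from every pin in `]0,γ]` any box solutions satisfy `h′ ≤ h` at every scale (in particular `h′ 1 ≤ h 1`). [folklore] -/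
theorem hinge_translate_le {Mt ε p : ℝ} {L : ℕ} (hb : 0 < b) (hMt : 0 ≤ Mt) (hε : 0 ≤ ε) (hLM : (L : ℝ) * Mt ≤ 1)
    (hp : 0 < p) (hpγ : p ≤ γ) (hh : SeqBox γ h) (hf : MemFlow (fun w : ℕ → ℝ => b + Mt * max (1 - 1 / w L ^ 2) 0) p h)
    (hh' : SeqBox γ h') (hf' : MemFlow (fun w : ℕ → ℝ => b + Mt * max (1 - 1 / w L ^ 2) 0 + ε) p h') (j : ℕ) : h' j ≤ h j := by
  refine hinge_le_of_moment_le_one (βb := b + Mt + ε) hb hMt hLM (fun u _ => B_le_B' hε u) (fun u hu => ?_) (fun u v _ _ _ => by simp only; linarith)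
    hp hpγ hh hf hh' hf' j
  show b + Mt * max (1 - 1 / u L ^ 2) 0 + ε ≤ b + Mt + ε
  have h0 : (0 : ℝ) ≤ 1 / u L ^ 2 := by positivity
  have h1 : max (1 - 1 / u L ^ 2) 0 ≤ 1 := max_le (by linarith) zero_le_one
  nlinarith [h1, hMt]

end Summit.QuantumFields.BalabanUV.Beta.EriceRemainderEnclosureHistoryAutonomyComparisonDualContractionHinge

end
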